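import Literature.Analysis.FluidPDE.LocalTypeI
import Literature.Analysis.FluidPDE.LocalTypeIScaling
import Literature.Analysis.FluidPDE.CKNScalingExtras
import Literature.Analysis.FluidPDE.NSBoundedHigherRegularityQuantProofs
import Literature.Analysis.FluidPDE.ESSLocalHolderRepresentative
import Literature.Analysis.FluidPDE.ESSLocalHolderBlowupLimit
import Literature.Analysis.FluidPDE.NSVorticityOfSmoothRepresentative
import Literature.Analysis.FluidPDE.ElgindiBlowup
import Literature.Analysis.FluidPDE.Vorticity
import Summits.NavierStokesRegularity.NavierStokesRegularity.Theorems.TerminalTraceTypeITraceScarL3StripRepresentative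
import HarnessLib

/-!
# UNIFORM quantitative regularity at depth for the extinct Type-I apex class
# (item `TerminalTrace.TypeITraceScarL3`, stmt-NavierStokesRegularity-18385; input (5.4)/(5.5) of the
# Carleman half `stub_quietShell_noConcentration` of line `annulus-dichotomy`, skeleton v4)

Seat ns-typeII-p3 g10 (cell ns-regularity-ideate), `--supports stmt-NavierStokesRegularity-18385` (helper).
Tao's second Carleman inequality at depth (the Gaussian lower bound (5.7), tree theorem
`vorticity_gaussian_lower_bound_annulus_integral`) consumes SUP bounds `|∇u| ≤ T⁻¹`, `|ω| ≤ M'/T`,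
`|∇ω| ≤ M'/T^{3/2}` on a whole-space slab at depth, and the shell ratio `A₀` of the cut may depend on the
class `(M, D₀, C)` only — so `M'` must be UNIFORM in the class.  This file proves exactly that:

* `exists_depth_iteratedFDeriv_le` — for every rate constant `C`, pressure level `D₀` and order `N` there
  is `K = K(C, D₀, N)` such that for EVERY pair `(U, P)` suitable in every `Q(a)` at the origin with
  `D(z₀, r) ≤ D₀` at apices `z₀.1 ≤ 0` and rate `‖U(s)‖ ≤ C/√(−s)` a.e., and every representative `v` of
  `U` on the open slab (`v = U` a.e., jointly continuous, smooth slices), one has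
  `‖∇ⁿ v(t, x)‖ ≤ K (−t)^{−(n+1)/2}` for all `n ≤ N`, `t < 0`, `x`.
  Proof: zoom by `μ = √(−t)` (the class is invariant: `IsSuitableWeakSolutionInBall.zoomOut`,
  `cknD_nsZoom`, the rate with the same `C` — adapted from `exists_depth_vorticity_floor_scaled` /
  `stub_no_confinedExtinctApex`); in the zoomed frame `|U'| ≤ 2|C|` on `Q_1((−½, x'))` and
  `∫_{Q_1}|P'|^{3/2} ≤ D₀`, so the UNIFORM higher-regularity bounds of Seregin–Šverák
  (`NSBoundedHigherRegularityBounds_holds.exists_uniform_bound`, data `(1, 2|C|, D₀)` only) bound all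
  `x`-derivatives of the smooth representative on `Q_{3/4}((−½, x')) ∋ (−1, x')`; that representative IS the
  zoom of `v` there (both continuous, a.e. equal on an open set), and un-zooming scales `∇ⁿ` by `μ^{−(n+1)}`.
* `exists_depth_gradient_vorticity_le` — the `(5.4)/(5.5)` package: `K₁, K₂ = K(C, D₀)` with
  `‖∇v‖ ≤ K₁/(−t)`, `‖ω‖ ≤ 4K₁/(−t)`, `‖∇ω‖ ≤ K₂ (−t)^{−3/2}` (`ω = vorticity v`).

WHAT THIS IS NOT: not Stub Q234 / QA / LOUD, not NS regularity — class bookkeeping of a printed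
regularity theorem. [cite: SereginSverak2009, §2 (p. 8) (higher derivatives of bounded weak solutions)]
-/

noncomputable section

set_option linter.dupNamespace false

namespace Summit.NavierStokesRegularity.NavierStokesRegularity.Theorems.TypeITraceScarL3

open MeasureTheory Set Function Filter Topology Metric
open Literature.Analysis.FluidPDE
open scoped NNReal ENNReal InnerProductSpace RealInnerProductSpace

/-! ### Homothety scaling of `iteratedFDeriv` -/

/-- **Scaling of derivatives under a homothety**: for `f` smooth and `μ > 0`,
`‖∇ⁿ(μ⁻¹ • f(μ⁻¹ •))(x)‖ ≤ μ^{−(n+1)} ‖∇ⁿ f(μ⁻¹ x)‖`. [folklore] -/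
theorem norm_iteratedFDeriv_inv_smul_comp_le
    {f : EuclideanSpace ℝ (Fin 3) → EuclideanSpace ℝ (Fin 3)} {n : ℕ} (hf : ContDiff ℝ n f)
    {μ : ℝ} (hμ : 0 < μ) (x : EuclideanSpace ℝ (Fin 3)) :
    ‖iteratedFDeriv ℝ n (fun y => μ⁻¹ • f (μ⁻¹ • y)) x‖ ≤
      μ⁻¹ ^ (n + 1) * ‖iteratedFDeriv ℝ n f (μ⁻¹ • x)‖ := by
  set g : EuclideanSpace ℝ (Fin 3) →L[ℝ] EuclideanSpace ℝ (Fin 3) :=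
    μ⁻¹ • ContinuousLinearMap.id ℝ (EuclideanSpace ℝ (Fin 3)) with hg
  have hgapply : ∀ y, g y = μ⁻¹ • y := fun y => by simp [hg]
  have hfg : ContDiff ℝ n (f ∘ g) := hf.comp g.contDiff
  have hfun : (fun y => μ⁻¹ • f (μ⁻¹ • y)) = μ⁻¹ • (f ∘ g) := by
    funext y; simp [hgapply]
  rw [hfun, iteratedFDeriv_const_smul_apply (hfg.contDiffAt), norm_smul,
    ContinuousLinearMap.iteratedFDeriv_comp_right g hf x (by exact_mod_cast le_rfl)]
  have hgn : ‖g‖ ≤ μ⁻¹ := by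
    rw [hg, norm_smul, Real.norm_of_nonneg (inv_pos.2 hμ).le]
    exact mul_le_of_le_one_right (inv_pos.2 hμ).le ContinuousLinearMap.norm_id_le
  calc ‖(μ⁻¹ : ℝ)‖ * ‖(iteratedFDeriv ℝ n f (g x)).compContinuousLinearMap fun _ => g‖
      ≤ μ⁻¹ * (‖iteratedFDeriv ℝ n f (g x)‖ * ∏ _i : Fin n, ‖g‖) := by
        rw [Real.norm_of_nonneg (inv_pos.2 hμ).le]
        exact mul_le_mul_of_nonneg_left (ContinuousMultilinearMap.norm_compContinuousLinearMap_le _ _)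
          (inv_pos.2 hμ).le
    _ ≤ μ⁻¹ * (‖iteratedFDeriv ℝ n f (g x)‖ * μ⁻¹ ^ n) := by
        refine mul_le_mul_of_nonneg_left (mul_le_mul_of_nonneg_left ?_ (norm_nonneg _)) (inv_pos.2 hμ).le
        rw [Finset.prod_const, Finset.card_fin]
        exact pow_le_pow_left₀ (norm_nonneg _) hgn n
    _ = μ⁻¹ ^ (n + 1) * ‖iteratedFDeriv ℝ n f (μ⁻¹ • x)‖ := by rw [hgapply]; ring

/-! ### The uniform derivative bounds at depth -/

/-- **UNIFORM QUANTITATIVE REGULARITY AT DEPTH for the extinct Type-I apex class.**  For every rate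
constant `C`, pressure level `D₀` and order `N` there is `K ≥ 0` such that: whenever `(U, P)` is suitable in
every parabolic ball `Q(a)` at the origin with `D(z₀, r) ≤ D₀` at apices `z₀.1 ≤ 0` and rate
`‖U(s, y)‖ ≤ C/√(−s)` (a.e. `y`, all `s < 0`), and `v` is a representative of `U` on the open slab
`{s < 0}` (a.e. equal, jointly continuous, with `C^∞` slices), then for all `n ≤ N`, `t < 0`, `x`:
`‖∇ⁿ v(t, ·)(x)‖ ≤ K (√(−t))^{−(n+1)}`.  (Seregin–Šverák higher regularity of bounded weak solutions with its
printed dependence of the norms — tree theorem `NSBoundedHigherRegularityBounds_holds` — in the zoomed frame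
`μ = √(−t)`, where the class data are `(1, 2|C|, D₀)`.) [cite: SereginSverak2009, §2 (p. 8)] -/
theorem exists_depth_iteratedFDeriv_le (C : ℝ) (D₀ : ℝ≥0) (N : ℕ) : ∃ K : ℝ, 0 ≤ K ∧
    ∀ (U : ℝ → EuclideanSpace ℝ (Fin 3) → EuclideanSpace ℝ (Fin 3))
      (P : ℝ → EuclideanSpace ℝ (Fin 3) → ℝ),
      (∀ a : ℝ, 0 < a →
        IsSuitableWeakSolutionInBall a (0 : ℝ × EuclideanSpace ℝ (Fin 3)) U P) →
      (∀ z₀ : ℝ × EuclideanSpace ℝ (Fin 3), z₀.1 ≤ 0 →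
        ∀ r : ℝ, 0 < r → cknD r z₀ P ≤ D₀) →
      (∀ s : ℝ, s < 0 →
        ∀ᵐ y : EuclideanSpace ℝ (Fin 3), ‖U s y‖ ≤ C / Real.sqrt (-s)) →
      ∀ v : ℝ → EuclideanSpace ℝ (Fin 3) → EuclideanSpace ℝ (Fin 3),
        (∀ᵐ w ∂(volume.restrict (Iio (0 : ℝ) ×ˢ (univ : Set (EuclideanSpace ℝ (Fin 3))))),
          uncurry U w = uncurry v w) →
        ContinuousOn (uncurry v) (Iio (0 : ℝ) ×ˢ (univ : Set (EuclideanSpace ℝ (Fin 3)))) →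
        (∀ t < 0, ContDiff ℝ (⊤ : ℕ∞) (v t)) →
        ∀ n ≤ N, ∀ t < 0, ∀ x : EuclideanSpace ℝ (Fin 3),
          ‖iteratedFDeriv ℝ n (v t) x‖ ≤ K * (Real.sqrt (-t))⁻¹ ^ (n + 1) := by
  -- ### the uniform constant of Seregin–Šverák for the data `(R, M, P) = (1, 2|C|, D₀)` on `Q_{3/4}`
  obtain ⟨K₀, hK₀⟩ := NSBoundedHigherRegularityBounds_holds.exists_uniform_bound 1 (2 * |C|) D₀
    (r := 3 / 4) ⟨by norm_num, by norm_num⟩ N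
  refine ⟨max K₀ 0, le_max_right _ _, fun U P hsw hD hrate v hvU hvc hvs n hn t ht x => ?_⟩
  -- ### the scale `μ = √(−t)` and the zoomed triple
  set μ : ℝ := Real.sqrt (-t) with hμdef
  have hμpos : 0 < μ := Real.sqrt_pos.2 (by linarith)
  have hμ0 : μ ≠ 0 := hμpos.ne'
  have hμ2 : 0 < μ ^ 2 := pow_pos hμpos 2
  have hμsq : μ ^ 2 = -t := Real.sq_sqrt (by linarith)
  set U' : ℝ → EuclideanSpace ℝ (Fin 3) → EuclideanSpace ℝ (Fin 3) :=
    μ • stPull (μ ^ 2) μ (0 : ℝ) (0 : EuclideanSpace ℝ (Fin 3)) U with hU'def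
  set P' : ℝ → EuclideanSpace ℝ (Fin 3) → ℝ :=
    μ ^ 2 • stPull (μ ^ 2) μ (0 : ℝ) (0 : EuclideanSpace ℝ (Fin 3)) P with hP'def
  set v' : ℝ → EuclideanSpace ℝ (Fin 3) → EuclideanSpace ℝ (Fin 3) :=
    fun s y => μ • v (μ ^ 2 * s) (μ • y) with hv'def
  have hU'apply : ∀ s y, U' s y = μ • U (μ ^ 2 * s) (μ • y) := fun s y => by
    rw [hU'def]; simp only [Pi.smul_apply, stPull_apply, zero_add]
  have hst0 : ∀ z : ℝ × EuclideanSpace ℝ (Fin 3),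
      stAffine (μ ^ 2) μ (0 : ℝ) (0 : EuclideanSpace ℝ (Fin 3)) z = (μ ^ 2 * z.1, μ • z.2) := by
    intro z
    rw [show z = (z.1, z.2) from rfl, stAffine_apply, zero_add, zero_add]
  -- (i) suitable in every `Q(a)` (adapted from `exists_depth_vorticity_floor_scaled`)
  have hsw' : ∀ a : ℝ, 0 < a →
      IsSuitableWeakSolutionInBall a (0 : ℝ × EuclideanSpace ℝ (Fin 3)) U' P' := by
    intro a ha
    have h := (hsw (a * μ) (mul_pos ha hμpos)).zoomOut hμpos
    rwa [mul_div_cancel_right₀ a hμ0] at h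
  -- (ii) the pressure bound at apices `≤ 0`
  have hD' : ∀ z₀ : ℝ × EuclideanSpace ℝ (Fin 3), z₀.1 ≤ 0 → ∀ r : ℝ, 0 < r → cknD r z₀ P' ≤ D₀ := by
    intro z₀ hz₀ r hr
    rw [hP'def, cknD_nsZoom hμpos hr]
    refine hD _ ?_ _ (mul_pos hμpos hr)
    rw [hst0]
    exact mul_nonpos_of_nonneg_of_nonpos hμ2.le hz₀
  -- (iii) the rate, same constant (adapted from `stub_no_confinedExtinctApex`, step (v))
  have hrate' : ∀ s : ℝ, s < 0 → ∀ᵐ y : EuclideanSpace ℝ (Fin 3), ‖U' s y‖ ≤ C / Real.sqrt (-s) := by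
    intro s hs
    have hs2 : μ ^ 2 * s < 0 := mul_neg_of_pos_of_neg hμ2 hs
    have h := (Measure.quasiMeasurePreserving_smul volume hμ0).ae (hrate (μ ^ 2 * s) hs2)
    filter_upwards [h] with y hy
    have hsq : Real.sqrt (-(μ ^ 2 * s)) = μ * Real.sqrt (-s) := by
      rw [show -(μ ^ 2 * s) = μ ^ 2 * (-s) by ring, Real.sqrt_mul hμ2.le, Real.sqrt_sq hμpos.le]
    rw [hU'apply, norm_smul, Real.norm_eq_abs, abs_of_pos hμpos]
    have hy' : ‖U (μ ^ 2 * s) (μ • y)‖ ≤ C / (μ * Real.sqrt (-s)) := by rw [← hsq]; exact hy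
    calc μ * ‖U (μ ^ 2 * s) (μ • y)‖ ≤ μ * (C / (μ * Real.sqrt (-s))) :=
          mul_le_mul_of_nonneg_left hy' hμpos.le
      _ = C / Real.sqrt (-s) := by field_simp
  -- ### the data of Seregin–Šverák on `Q_1((−½, x'))`, `x' = μ⁻¹ x`
  set x' : EuclideanSpace ℝ (Fin 3) := μ⁻¹ • x with hx'
  set z₁ : ℝ × EuclideanSpace ℝ (Fin 3) := ((-(1 / 2) : ℝ), x') with hz₁
  have hQsub : parabolicCylinder 1 z₁ ⊆ Iio (0 : ℝ) ×ˢ (univ : Set (EuclideanSpace ℝ (Fin 3))) := by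
    rintro ⟨s, y⟩ hw
    rw [mem_parabolicCylinder] at hw
    exact ⟨by have := hw.1.2; simp only [hz₁] at this; exact lt_trans this (by norm_num), mem_univ _⟩
  -- distributional solution on the cylinder
  have hdist : IsDistributionalNSSolutionOn (parabolicCylinderOpens 1 z₁) 1 0 U' P' := by
    have h := isDistributionalNSSolutionOn_of_forall_cylinder
      (fun a ha => (hsw' a ha).1.distributional) (isOpen_parabolicCylinder 1 z₁) hQsub
    exact h
  -- the sup bound `2|C|` on the cylinder (times in `]−3/2, −1/2[`)
  have hbd : ∀ᵐ w ∂(volume.restrict (parabolicCylinder 1 z₁)), ‖U' w.1 w.2‖ ≤ 2 * |C| := by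
    have hstrip := ae_norm_le_strip_of_rate hsw' hrate' (a := -(1 / 2) - 1 ^ 2) (b := -(1 / 2))
      (by norm_num)
    have hsub : parabolicCylinder 1 z₁ ⊆ Ioo (-(1 / 2) - 1 ^ 2) (-(1 / 2)) ×ˢ
        (univ : Set (EuclideanSpace ℝ (Fin 3))) := by
      rintro ⟨s, y⟩ hw
      rw [mem_parabolicCylinder] at hw
      exact ⟨by simpa [hz₁] using hw.1, mem_univ _⟩
    filter_upwards [ae_restrict_of_ae_restrict_of_subset hsub hstrip] with w hw
    refine hw.trans ?_
    have hs : Real.sqrt (-(-(1 / 2) : ℝ)) = Real.sqrt (1 / 2) := by norm_num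
    rw [hs, div_le_iff₀ (Real.sqrt_pos.2 (by norm_num))]
    have h12 : (1 : ℝ) / 2 ≤ Real.sqrt (1 / 2) := by
      rw [show (1 : ℝ) / 2 = Real.sqrt ((1 / 2) ^ 2) by rw [Real.sqrt_sq (by norm_num)]]
      exact Real.sqrt_le_sqrt (by norm_num)
    nlinarith [abs_nonneg C]
  -- the pressure bound on the cylinder (`r = 1`: the prefactor of `D` is `1`)
  have hp : ∫⁻ w in parabolicCylinder 1 z₁, ‖P' w.1 w.2‖ₑ ^ (3 / 2 : ℝ) ≤ D₀ := by
    have h := hD' z₁ (by rw [hz₁]; norm_num) 1 one_pos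
    simpa [cknD] using h
  -- ### the smooth representative with the UNIFORM bounds
  obtain ⟨V, hae, hVc, -, -, hVbd⟩ := hK₀ U' P' z₁ hdist hbd hp
  -- `v'` is continuous on the open slab
  have hv'c : ContinuousOn (uncurry v') (Iio (0 : ℝ) ×ˢ (univ : Set (EuclideanSpace ℝ (Fin 3)))) := by
    have h1 : uncurry v' = fun w => μ • uncurry v (stAffine (μ ^ 2) μ 0 0 w) := by
      funext w
      rw [hst0]
      rfl
    rw [h1]
    refine ContinuousOn.const_smul (hvc.comp (continuous_stAffine _ _ _ _).continuousOn ?_) μ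
    rintro ⟨s, y⟩ ⟨hs, -⟩
    rw [hst0]
    exact ⟨mul_neg_of_pos_of_neg hμ2 hs, mem_univ _⟩
  -- `v' = U'` a.e. on the cylinder (transport of `v = U` a.e. by the zoom)
  have hv'U' : uncurry v' =ᵐ[volume.restrict (parabolicCylinder 1 z₁)] uncurry U' := by
    have hSm : MeasurableSet (Iio (0 : ℝ) ×ˢ (univ : Set (EuclideanSpace ℝ (Fin 3)))) :=
      measurableSet_Iio.prod MeasurableSet.univ
    have h1 : ∀ᵐ w ∂(volume : Measure (ℝ × EuclideanSpace ℝ (Fin 3))),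
        w ∈ Iio (0 : ℝ) ×ˢ (univ : Set (EuclideanSpace ℝ (Fin 3))) → uncurry U w = uncurry v w :=
      (ae_restrict_iff' hSm).1 hvU
    have h2 := (quasiMeasurePreserving_stAffine (E := EuclideanSpace ℝ (Fin 3)) hμ2 hμpos (0 : ℝ)
      (0 : EuclideanSpace ℝ (Fin 3))).ae h1
    have h3 : ∀ᵐ w ∂(volume : Measure (ℝ × EuclideanSpace ℝ (Fin 3))),
        w ∈ parabolicCylinder 1 z₁ → uncurry v' w = uncurry U' w := by
      filter_upwards [h2] with w hw hwQ
      have hwS : stAffine (μ ^ 2) μ 0 0 w ∈ Iio (0 : ℝ) ×ˢ (univ : Set (EuclideanSpace ℝ (Fin 3))) := by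
        rw [hst0]
        exact ⟨mul_neg_of_pos_of_neg hμ2 (hQsub hwQ).1, mem_univ _⟩
      have h4 := hw hwS
      rw [hst0] at h4
      simp only [uncurry] at h4 ⊢
      rw [hU'apply, hv'def, h4]
    exact (ae_restrict_iff' (isOpen_parabolicCylinder 1 z₁).measurableSet).2 h3
  have hVv' : EqOn (uncurry V) (uncurry v') (parabolicCylinder 1 z₁) :=
    Measure.eqOn_open_of_ae_eq (hae.symm.trans hv'U'.symm) (isOpen_parabolicCylinder 1 z₁) hVc
      (hv'c.mono hQsub)
  -- ### the bound at the point `(−1, x')`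
  have hw₁ : (((-1 : ℝ), x') : ℝ × EuclideanSpace ℝ (Fin 3)) ∈ parabolicCylinder (3 / 4) z₁ := by
    rw [mem_parabolicCylinder, hz₁]
    refine ⟨⟨by norm_num, by norm_num⟩, by simp⟩
  have hbdV := hVbd n hn _ hw₁
  -- `V(−1) = v'(−1)` near `x'`
  have hVeq : V (-1) =ᶠ[𝓝 x'] v' (-1) := by
    filter_upwards [ball_mem_nhds x' one_pos] with y hy
    have hyQ : (((-1 : ℝ), y) : ℝ × EuclideanSpace ℝ (Fin 3)) ∈ parabolicCylinder 1 z₁ := by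
      rw [mem_parabolicCylinder, hz₁]
      exact ⟨⟨by norm_num, by norm_num⟩, mem_ball.1 hy⟩
    exact hVv' hyQ
  have hbdv' : ‖iteratedFDeriv ℝ n (v' (-1)) x'‖ ≤ K₀ := by
    rw [← (hVeq.iteratedFDeriv ℝ n).self_of_nhds]
    simpa using hbdV
  -- ### un-zoom: `v t = μ⁻¹ • v'(−1) (μ⁻¹ •)`
  have hv'slice : v' (-1) = fun y => μ • v t (μ • y) := by
    funext y
    rw [hv'def]
    simp only
    rw [show μ ^ 2 * (-1 : ℝ) = t by rw [hμsq]; ring]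
  have hv'smooth : ContDiff ℝ n (v' (-1)) := by
    rw [hv'slice]
    exact (((hvs t ht).of_le (by exact_mod_cast le_top)).comp (contDiff_const_smul μ)).const_smul μ
  have hvt : v t = fun y => μ⁻¹ • v' (-1) (μ⁻¹ • y) := by
    funext y
    rw [hv'slice]
    dsimp only
    rw [smul_smul, inv_mul_cancel₀ hμ0, one_smul, smul_smul, mul_inv_cancel₀ hμ0, one_smul]
  rw [hvt]
  calc ‖iteratedFDeriv ℝ n (fun y => μ⁻¹ • v' (-1) (μ⁻¹ • y)) x‖
      ≤ μ⁻¹ ^ (n + 1) * ‖iteratedFDeriv ℝ n (v' (-1)) (μ⁻¹ • x)‖ :=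
        norm_iteratedFDeriv_inv_smul_comp_le hv'smooth hμpos x
    _ ≤ μ⁻¹ ^ (n + 1) * K₀ := mul_le_mul_of_nonneg_left hbdv' (by positivity)
    _ ≤ max K₀ 0 * (Real.sqrt (-t))⁻¹ ^ (n + 1) := by
        rw [mul_comm]
        exact mul_le_mul_of_nonneg_right (le_max_left _ _) (by positivity)

/-- **The `(5.4)/(5.5)` package at depth, UNIFORM in the class.**  For every `C`, `D₀` there are
`K₁, K₂ ≥ 0` such that for every apex pair `(U, P)` as above and every continuous representative `v` with
smooth slices: `‖∇v(t,x)‖ ≤ K₁/(−t)`, `‖ω(t,x)‖ ≤ 4K₁/(−t)`, `‖∇ω(t,x)‖ ≤ K₂/((−t)√(−t))` for all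
`t < 0`, `x` (`ω = vorticity v`; `‖curl‖ ≤ 4‖∇·‖`, `‖∇curl‖ ≤ ‖curlCLM‖ ‖∇²·‖`).
[cite: SereginSverak2009, §2 (p. 8)] -/
theorem exists_depth_gradient_vorticity_le (C : ℝ) (D₀ : ℝ≥0) : ∃ K₁ K₂ : ℝ, 0 ≤ K₁ ∧ 0 ≤ K₂ ∧
    ∀ (U : ℝ → EuclideanSpace ℝ (Fin 3) → EuclideanSpace ℝ (Fin 3))
      (P : ℝ → EuclideanSpace ℝ (Fin 3) → ℝ),
      (∀ a : ℝ, 0 < a →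
        IsSuitableWeakSolutionInBall a (0 : ℝ × EuclideanSpace ℝ (Fin 3)) U P) →
      (∀ z₀ : ℝ × EuclideanSpace ℝ (Fin 3), z₀.1 ≤ 0 →
        ∀ r : ℝ, 0 < r → cknD r z₀ P ≤ D₀) →
      (∀ s : ℝ, s < 0 →
        ∀ᵐ y : EuclideanSpace ℝ (Fin 3), ‖U s y‖ ≤ C / Real.sqrt (-s)) →
      ∀ v : ℝ → EuclideanSpace ℝ (Fin 3) → EuclideanSpace ℝ (Fin 3),
        (∀ᵐ w ∂(volume.restrict (Iio (0 : ℝ) ×ˢ (univ : Set (EuclideanSpace ℝ (Fin 3))))),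
          uncurry U w = uncurry v w) →
        ContinuousOn (uncurry v) (Iio (0 : ℝ) ×ˢ (univ : Set (EuclideanSpace ℝ (Fin 3)))) →
        (∀ t < 0, ContDiff ℝ (⊤ : ℕ∞) (v t)) →
        ∀ t < 0, ∀ x : EuclideanSpace ℝ (Fin 3),
          ‖fderiv ℝ (v t) x‖ ≤ K₁ / (-t) ∧ ‖vorticity v t x‖ ≤ 4 * K₁ / (-t) ∧
          ‖fderiv ℝ (vorticity v t) x‖ ≤ K₂ / ((-t) * Real.sqrt (-t)) := by
  obtain ⟨K, hK, hbd⟩ := exists_depth_iteratedFDeriv_le C D₀ 2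
  refine ⟨K, ‖curlCLM‖ * K, hK, by positivity, fun U P hsw hD hrate v hvU hvc hvs t ht x => ?_⟩
  have hmt : 0 < -t := by linarith
  have hsq : 0 < Real.sqrt (-t) := Real.sqrt_pos.2 hmt
  have hsq2 : Real.sqrt (-t) ^ 2 = -t := Real.sq_sqrt hmt.le
  have h1 := hbd U P hsw hD hrate v hvU hvc hvs 1 (by norm_num) t ht x
  have h2 := hbd U P hsw hD hrate v hvU hvc hvs 2 le_rfl t ht x
  rw [norm_iteratedFDeriv_one] at h1
  have e1 : K * (Real.sqrt (-t))⁻¹ ^ (1 + 1) = K / (-t) := by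
    rw [inv_pow, show ((1 : ℕ) + 1) = 2 from rfl, hsq2]; ring
  have e2 : K * (Real.sqrt (-t))⁻¹ ^ (2 + 1) = K / ((-t) * Real.sqrt (-t)) := by
    rw [inv_pow, pow_succ, hsq2]; ring
  rw [e1] at h1
  rw [e2] at h2
  refine ⟨h1, ?_, ?_⟩
  · calc ‖vorticity v t x‖ = ‖curl (v t) x‖ := rfl
      _ ≤ 4 * ‖fderiv ℝ (v t) x‖ := norm_curl_le_four_mul _ _
      _ ≤ 4 * (K / (-t)) := by linarith
      _ = 4 * K / (-t) := by ring
  · have hv2 : ContDiff ℝ 2 (v t) := (hvs t ht).of_le (by norm_cast)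
    calc ‖fderiv ℝ (vorticity v t) x‖ = ‖fderiv ℝ (curl (v t)) x‖ := rfl
      _ ≤ ‖curlCLM‖ * ‖iteratedFDeriv ℝ 2 (v t) x‖ := norm_fderiv_curl_le hv2 x
      _ ≤ ‖curlCLM‖ * (K / ((-t) * Real.sqrt (-t))) := mul_le_mul_of_nonneg_left h2 (norm_nonneg curlCLM)
      _ = ‖curlCLM‖ * K / ((-t) * Real.sqrt (-t)) := by ring

end Summit.NavierStokesRegularity.NavierStokesRegularity.Theorems.TypeITraceScarL3

end
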